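/-
Copyright (c) 2026 the pub-hodgecm-mathlib formalisation cell (harness21).  Prover seat hodgecm-mathlib-K2Liu-p07 (g0),
Track B «K2-LIT» ∕ hLiu418 #184♮, unit U3a «SIEGEL EISENSTEIN SERIES» of the K2_Liu road, file #15a: payment of the socket
`K2LiuCurveThetaSigsU3aSiegelEisenstein.sig_K2LiuSiegelDeltaHeightExists` — A CONTINUOUS `P_Δ`-HEIGHT EXISTS (continuity of the
★ Plücker height of record).  2026-09-03.
-/
import Summits.HodgeConjecture.HodgeConjecture.Theorems.K2LiuSiegelDoubledPluckerHeight   -- ★ p854922 (K2Liu-p09): the height of record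
import Literature.NumberTheory.Automorphic.GLnAdelicStructure                            -- ★ `glFiniteIntegralLevel`, `GLn.sndHom`
import Literature.NumberTheory.Automorphic.AutomorphicFormsGLContinuous                  -- ★ `GLn.continuous_sndHom`
import Literature.NumberTheory.Automorphic.AdelicGroupData                               -- ★ `AdelicGroupData.adeleEval`
import Mathlib.Topology.Algebra.Group.Matrix
import Mathlib.Analysis.SpecialFunctions.Pow.Continuity                                  -- `Continuous.rpow_const`
import HarnessLib

/-!
# K2_Liu road (hLiu418 = stmt-HodgeConjecture-24832), unit U3a, file #15a:
# the Plücker height of the doubled unitary group is CONTINUOUS — a continuous `(P_Δ, |det_Δ|^{1∕2})`-height exists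

Cell `pub/hodgecm-mathlib` (D-0151), Track B (21-frontier RULING «PUSH BOTH» 2026-09-03, director req621∕req624,
LEAD F0P6-plan «M-154j»), socket module
`Summits/HodgeConjecture/HodgeConjecture/Cruxes/HLiu418/Lines/K2_Liu_CurveThetaSigs_U3a_SiegelEisenstein.lean` (ED. 2, a17247f4227b10e7,
planner K2Liu-plan (g0)), socket **`sig_K2LiuSiegelDeltaHeightExists`** (#15a, M): for non-degenerate data there is a CONTINUOUS
`Φ : H(𝔸) → ℝ_{>0}` on the doubled unitary group `H(𝔸) = U(𝕍 ⊕ −𝕍)(𝔸)` (★ `GRConstruction.HA`) with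
`Φ(p x) = modDelta(p) · Φ(x)` for `p ∈ P_Δ(𝔸)` (★ `IsSiegelDelta`, ★ `modDelta p = |det_Δ p|_𝔸^{1∕2}`).

THE HEIGHT OF RECORD (LEAD F0P6-plan 21:38:45Z) is K2Liu-p09's ★ Plücker height
`Theorems/K2LiuSiegelDoubledPluckerHeight.exists_siegelHeight` (p854922): `Φ(h) = h_L(π(h))^{−1∕2}` with `π(h) = ξ₀ · h^{(n)}` the
row `I₁` of the `n`-th compound of `R₀ h`, `R₀ = (1 | −1) ∘ e₂⁻¹` the annihilator frame of `Δ`, `h_L = ` ★ `vecHeight` (Godement–Garrett);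
★ proves (1) `Φ > 0`, (2) the `(P_Δ, modDelta)` law, (3) lower bounds on compacta, (4) Godement's floor — but not continuity.
THIS FILE proves that `h ↦ h_L(ξ · h^{(k)})` is CONTINUOUS on `GL_N(𝔸)` for every adelic vector `ξ` ([Garrett2018, §2.2]: «for all but
finitely many `v` the local height is `1`»; [MoeglinWaldspurger1995, I.2.2]), exactly as ★ `UnitaryGroupBorelHeightContinuous` does for the
last row, and re-assembles the SAME `Φ` with continuity added — ONE `Φ` for #9, #14a, #15b, #16 (LEAD 21:20:27Z «one Φ shared»):

* §1 `det_snd_mem_of_forall_mem` (a determinant of `v`-integral adeles is `v`-integral), `vecFinHeight_vecMul_compound_mul_of_mem` —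
  the finite local heights `h_v(ξ · g^{(k)})` are unchanged under `g ↦ g u` for `u_f ∈ GL_N(𝒪̂)` (Binet–Cauchy ★ `compound_mul`, the minors of
  `u`, `u⁻¹` are integral, ★ `vecFinHeight_vecMul_eq_of_forall_mem`), hence `isLocallyConstant_finprod_vecFinHeight_vecMul_compound`;
* §2 `continuous_vecArchNorm_vecMul_compound` (minors are polynomials: ★ `continuous_compound`), **`continuous_vecHeight_vecMul_compound`**;
* §3 the head **`siegelDeltaHeightExists`** = the socket TOKEN FOR TOKEN ((1)(2) re-derived from ★ p854922's lemmas, adapted), and the bonus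
  **`exists_siegelHeight_continuous`**: `∃ Φ`, (0) `Continuous Φ` ∧ (1) ∧ (2) ∧ (3) ∧ (4) — ★ `exists_siegelHeight` with continuity.

HONEST LABEL: HC_CM is proved only modulo the 7 printed citations (2 remaining named inputs: hLiu418 = stmt-HodgeConjecture-24832,
h413 = stmt-HodgeConjecture-24833) until rung 0 closes; this file is a `--supports stmt-HodgeConjecture-24832` helper (SIG TABLE row #15a)
and retires nothing by itself.

## References
* [Garrett2018] P. Garrett, *Modern Analysis of Automorphic Forms by Example* (2018), §2.2 (PDF pp. 81–83: local heights, finitely many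
  `≠ 1`), §3.10 (proof of Cor. 3.10.2: the height attached to a maximal parabolic).
* [MoeglinWaldspurger1995] C. Mœglin, J.-L. Waldspurger, *Spectral decomposition and Eisenstein series* (1995), I.2.2 (heights, continuity).
* [Godement1964] R. Godement, *Domaines fondamentaux des groupes arithmétiques*, Sém. Bourbaki 257, §1.1.
-/

set_option autoImplicit false
-- the mandated namespace repeats the single-problem summit's segment (`HodgeConjecture.HodgeConjecture`)
set_option linter.dupNamespace false

noncomputable section

open scoped Matrix NNReal
open NumberField IsDedekindDomain Topology

namespace Summit.HodgeConjecture.HodgeConjecture.Cruxes.HLiu418.K2LiuSiegelDeltaHeightExists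

open Literature.NumberTheory.Automorphic Literature.NumberTheory.Automorphic.UnitaryGroup
open Literature.NumberTheory.GelbartRogawski1991 Literature.NumberTheory.GelbartRogawski1991.GRConstruction
open Literature.LinearAlgebra.Matrix
open Summit.HodgeConjecture.HodgeConjecture.Cruxes.HLiu418.K2LiuSiegelDoubledPluckerFrame
open Summit.HodgeConjecture.HodgeConjecture.Cruxes.HLiu418.K2LiuSiegelDoubledPluckerHeight

/-! ## §1 The finite part of the Plücker height is locally constant on `GL_N(𝔸)` -/

section General

variable (K : Type) [Field K] [NumberField K] {N k : ℕ}

/-- **A determinant of `v`-integral adeles is `v`-integral** (the `v`-component is a ring homomorphism ★ `AdelicGroupData.adeleEval`,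
and `det` of a matrix over the subring `𝒪_v` lies in `𝒪_v`). [folklore] -/
theorem det_snd_mem_of_forall_mem {m : Type*} [Fintype m] [DecidableEq m] (v : HeightOneSpectrum (𝓞 K))
    {M : Matrix m m (AdeleRing (𝓞 K) K)} (h : ∀ i j, (M i j).2 v ∈ v.adicCompletionIntegers K) :
    (M.det).2 v ∈ v.adicCompletionIntegers K := by
  let f : AdeleRing (𝓞 K) K →+* v.adicCompletion K := AdelicGroupData.adeleEval K v
  let M' : Matrix m m (v.adicCompletionIntegers K) := fun i j => ⟨(M i j).2 v, h i j⟩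
  have hM : f.mapMatrix M = (v.adicCompletionIntegers K).subtype.mapMatrix M' := by
    ext i j
    rfl
  have hdet : (M.det).2 v = f M.det := rfl
  rw [hdet, RingHom.map_det, hM, ← RingHom.map_det]
  exact SetLike.coe_mem _

/-- **`h_v(ξ · (g u)^{(k)}) = h_v(ξ · g^{(k)})` for `u_f ∈ GL_N(𝒪̂_K)`**: `(g u)^{(k)} = g^{(k)} u^{(k)}` (Binet–Cauchy ★ `compound_mul`),
`u^{(k)} ∈ GL` with inverse `(u⁻¹)^{(k)}` (★ `exists_compoundGL`), and the minors of `u`, `u⁻¹` are `v`-integral, so the finite local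
height is unchanged (★ `vecFinHeight_vecMul_eq_of_forall_mem`; Garrett: «the isometry groups of the `h_v` are the compact `K_v`»).
[cite: Garrett2018, §2.2 (PDF p. 81)] -/
theorem vecFinHeight_vecMul_compound_mul_of_mem (x : Set.powersetCard (Fin N) k → AdeleRing (𝓞 K) K)
    (g : GL (Fin N) (AdeleRing (𝓞 K) K)) {u : GL (Fin N) (AdeleRing (𝓞 K) K)}
    (hu : GLn.sndHom N K u ∈ glFiniteIntegralLevel N K) (v : HeightOneSpectrum (𝓞 K)) :
    vecFinHeight K v (x ᵥ* compound k ((g * u : GL (Fin N) (AdeleRing (𝓞 K) K)) : Matrix (Fin N) (Fin N) (AdeleRing (𝓞 K) K))) =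
      vecFinHeight K v (x ᵥ* compound k (g : Matrix (Fin N) (Fin N) (AdeleRing (𝓞 K) K))) := by
  classical
  obtain ⟨G, hG, hGinv⟩ := exists_compoundGL K (k := k) u
  obtain ⟨h1, h2⟩ := mem_glFiniteIntegralLevel_iff.1 hu
  rw [Units.val_mul, compound_mul, ← Matrix.vecMul_vecMul, ← hG]
  have hint : ∀ a b, (((u : GL (Fin N) (AdeleRing (𝓞 K) K)) : Matrix (Fin N) (Fin N) (AdeleRing (𝓞 K) K)) a b).2 v ∈
      v.adicCompletionIntegers K := fun a b => (mem_integralFiniteAdeles_iff.1 (h1 a b)) v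
  have hinv : ∀ a b, (((u⁻¹ : GL (Fin N) (AdeleRing (𝓞 K) K)) : Matrix (Fin N) (Fin N) (AdeleRing (𝓞 K) K)) a b).2 v ∈
      v.adicCompletionIntegers K := fun a b => by
    have h := h2 a b
    rw [← map_inv] at h
    exact (mem_integralFiniteAdeles_iff.1 h) v
  refine vecFinHeight_vecMul_eq_of_forall_mem v _ G (fun I J => ?_) (fun I J => ?_)
  · rw [hG, compound_apply]
    exact det_snd_mem_of_forall_mem K v fun i j => hint _ _
  · rw [hGinv, compound_apply]
    exact det_snd_mem_of_forall_mem K v fun i j => hinv _ _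

/-- **The finite part `∏ᶠ_v h_v(ξ · g^{(k)})` of the Plücker height is locally constant on `GL_N(𝔸_K)`**: constant on the cosets `g U`
of the OPEN subgroup `U = {u : u_f ∈ GL_N(𝒪̂_K)}` (★ `isOpen_glFiniteIntegralLevel`, ★ `GLn.continuous_sndHom`).
[cite: Garrett2018, §2.2 (PDF p. 82)] -/
theorem isLocallyConstant_finprod_vecFinHeight_vecMul_compound (x : Set.powersetCard (Fin N) k → AdeleRing (𝓞 K) K) :
    IsLocallyConstant fun g : GL (Fin N) (AdeleRing (𝓞 K) K) =>
      ∏ᶠ v, vecFinHeight K v (x ᵥ* compound k (g : Matrix (Fin N) (Fin N) (AdeleRing (𝓞 K) K))) := by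
  let U : Subgroup (GL (Fin N) (AdeleRing (𝓞 K) K)) := (glFiniteIntegralLevel N K).comap (GLn.sndHom N K)
  have hUo : IsOpen (U : Set (GL (Fin N) (AdeleRing (𝓞 K) K))) :=
    (isOpen_glFiniteIntegralLevel N K).preimage GLn.continuous_sndHom
  refine (IsLocallyConstant.iff_exists_open _).2 fun g => ⟨(fun u => g * u) '' (U : Set _), ?_, ?_, ?_⟩
  · exact (Homeomorph.mulLeft g).isOpenMap _ hUo
  · exact ⟨1, U.one_mem, mul_one g⟩
  · rintro _ ⟨u, hu, rfl⟩
    exact finprod_congr fun v => vecFinHeight_vecMul_compound_mul_of_mem K x g (Subgroup.mem_comap.1 hu) v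

/-! ## §2 The archimedean part; the Plücker height is continuous on `GL_N(𝔸)` -/

/-- The coordinates of `ξ · g^{(k)}` are polynomials in the entries of `g`, hence continuous (★ `continuous_compound`). [folklore] -/
theorem continuous_vecMul_compound_apply (x : Set.powersetCard (Fin N) k → AdeleRing (𝓞 K) K) (J : Set.powersetCard (Fin N) k) :
    Continuous fun g : GL (Fin N) (AdeleRing (𝓞 K) K) =>
      (x ᵥ* compound k (g : Matrix (Fin N) (Fin N) (AdeleRing (𝓞 K) K))) J := by
  simp only [Matrix.vecMul, dotProduct]
  exact continuous_finsetSum _ fun I _ =>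
    continuous_const.mul (((continuous_compound (k := k)).comp Units.continuous_val).matrix_elem I J)

/-- **The archimedean norms `‖ξ · g^{(k)}‖_w` are continuous in `g`.** [cite: Garrett2018, §2.2 (PDF p. 81)] -/
theorem continuous_vecArchNorm_vecMul_compound (x : Set.powersetCard (Fin N) k → AdeleRing (𝓞 K) K) (w : InfinitePlace K) :
    Continuous fun g : GL (Fin N) (AdeleRing (𝓞 K) K) =>
      vecArchNorm K w (x ᵥ* compound k (g : Matrix (Fin N) (Fin N) (AdeleRing (𝓞 K) K))) := by
  unfold vecArchNorm
  refine NNReal.continuous_sqrt.comp (continuous_finsetSum _ fun J _ => ?_)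
  refine (Continuous.nnnorm ?_).pow 2
  exact (continuous_apply w).comp (continuous_fst.comp (continuous_vecMul_compound_apply K x J))

/-- **The Plücker height `g ↦ h_K(ξ · g^{(k)})` is continuous on `GL_N(𝔸_K)`** (`h = ∏_w ‖·‖_w^{mult w} · ∏ᶠ_v h_v`: finitely many
continuous archimedean factors times the locally constant finite part). [cite: Garrett2018, §2.2 (PDF p. 82)] [cite: MoeglinWaldspurger1995, I.2.2] -/
theorem continuous_vecHeight_vecMul_compound (x : Set.powersetCard (Fin N) k → AdeleRing (𝓞 K) K) :
    Continuous fun g : GL (Fin N) (AdeleRing (𝓞 K) K) =>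
      vecHeight K (x ᵥ* compound k (g : Matrix (Fin N) (Fin N) (AdeleRing (𝓞 K) K))) := by
  unfold vecHeight
  exact (continuous_finsetProd _ fun w _ => (continuous_vecArchNorm_vecMul_compound K x w).pow _).mul
    (isLocallyConstant_finprod_vecFinHeight_vecMul_compound K x).continuous

end General

/-! ## §3 The continuous Siegel height on `H(𝔸) = U(𝕍 ⊕ −𝕍)(𝔸)` -/

section Doubled

open Literature.NumberTheory.GaloisRepresentations (HeckeCharacter)

variable (L : Type) [Field L] [NumberField L] [IsCMField L]
variable {N M n : ℕ} (e : Fin N × Fin M ≃ Fin n)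
  (dV : Fin N → L) (hdV : ∀ i, IsCMField.complexConj L (dV i) = dV i)
  (dW : Fin M → L) (hdW : ∀ i, IsCMField.complexConj L (dW i) = dW i)

/-- **THE PLÜCKER HEIGHT OF RECORD, WITH CONTINUITY.**  For non-degenerate data there is `Φ : H(𝔸) → ℝ` with
(0) `Φ` CONTINUOUS; (1) `Φ > 0`; (2) `Φ(p h) = modDelta(p) · Φ(h)` for `p ∈ P_Δ(𝔸)`; (3) `Φ ≥ c_K > 0` on every compact `K`;
(4) Godement's floor `Φ(γ k) ≤ C_K` for rational `γ` and `k ∈ K`.  Namely ★ K2Liu-p09's `Φ(h) = h_L(ξ₀ · h^{(n)})^{−1∕2}`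
(★ `exists_siegelHeight`, whose proof of (1)–(4) is re-run verbatim — adapted from ★ p854922 — so that (0), §2 composed with the
inclusion `H(𝔸) ≤ GL_{2n}(𝔸_L)` and `t ↦ t^{−1∕2}` on `t > 0`, refers to the SAME `Φ`).  One height for #9, #14a, #15b, #16.
[cite: Garrett2018, §2.2 (PDF p. 82), §3.10] [cite: Godement1964, §1.1] [cite: Liu2021, Lem. B.10 (2) p. 102] -/
theorem exists_siegelHeight_continuous (hdV0 : ∀ i, dV i ≠ 0) (hdW0 : ∀ i, dW i ≠ 0) :
    ∃ Φ : HA L e dV hdV dW hdW → ℝ, Continuous Φ ∧ (∀ x, 0 < Φ x) ∧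
      (∀ p x : HA L e dV hdV dW hdW, IsSiegelDelta L e dV hdV dW hdW p →
        Φ (p * x) = modDelta L e dV hdV dW hdW p * Φ x) ∧
      (∀ K : Set (HA L e dV hdV dW hdW), IsCompact K → ∃ c : ℝ, 0 < c ∧ ∀ k ∈ K, c ≤ Φ k) ∧
      (∀ K : Set (HA L e dV hdV dW hdW), IsCompact K → ∃ C : ℝ, ∀ k ∈ K, ∀ γ : ratH L e dV hdV dW hdW,
        Φ ((γ : HA L e dV hdV dW hdW) * k) ≤ C) := by
  classical
  -- the rational frame row `ξ₀` and the Plücker vector `π(x) = ξ₀ · x^{(n)}` (adapted from ★ p854922 `exists_siegelHeight`)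
  set R₀L : Matrix (Fin n) (Fin (n + n)) L :=
    (Matrix.fromCols (1 : Matrix (Fin n) (Fin n) L) (-(1 : Matrix (Fin n) (Fin n) L)) :
      Matrix (Fin n) (Fin n ⊕ Fin n) L).submatrix id (e₂ (n := n)).symm with hR₀L
  have hcard : (Finset.univ : Finset (Fin n)).card = n := by rw [Finset.card_univ, Fintype.card_fin]
  set I₁ : Set.powersetCard (Fin n) n := Set.powersetCard.ofCard hcard with hI₁
  set ξ₀ : Set.powersetCard (Fin (n + n)) n → L := fun J => compound n R₀L I₁ J with hξ₀
  have hξ₀ne : ξ₀ ≠ 0 := frame_compound_row_ne_zero L I₁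
  set π : HA L e dV hdV dW hdW → Set.powersetCard (Fin (n + n)) n → AdeleRing (𝓞 L) L := fun x =>
    principalVec L ξ₀ ᵥ* compound n ((x : GL (Fin (n + n)) (AdeleRing (𝓞 L) L)) : Matrix (Fin (n + n)) (Fin (n + n)) (AdeleRing (𝓞 L) L))
    with hπ
  -- the row form `π(x) J = ((R₀ x)^{(n)})_{I₁ J}` (★ `pluckerVec_eq_principalVec_vecMul`)
  have hπrow : ∀ x : HA L e dV hdV dW hdW, (fun J => compound n ((Matrix.fromCols (1 : Matrix (Fin n) (Fin n) (AdeleRing (𝓞 L) L))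
      (-(1 : Matrix (Fin n) (Fin n) (AdeleRing (𝓞 L) L))) : Matrix (Fin n) (Fin n ⊕ Fin n) (AdeleRing (𝓞 L) L)).submatrix id
        (e₂ (n := n)).symm * ((x : GL (Fin (n + n)) (AdeleRing (𝓞 L) L)) : Matrix (Fin (n + n)) (Fin (n + n)) (AdeleRing (𝓞 L) L))) I₁ J) =
      π x := fun x => pluckerVec_eq_principalVec_vecMul L e dV hdV dW hdW x I₁
  -- the height and Φ
  set H : HA L e dV hdV dW hdW → ℝ≥0 := fun x => vecHeight L (π x) with hH
  have hHpos : ∀ x, 0 < H x := fun x => vecHeight_principalVec_vecMul_compound_pos L hξ₀ne _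
  have hHfin : ∀ x, IsHeightFinite L (π x) := fun x => isHeightFinite_principalVec_vecMul_compound L hξ₀ne _
  have hHcont : Continuous H :=
    (continuous_vecHeight_vecMul_compound L (principalVec L ξ₀)).comp continuous_subtype_val
  refine ⟨fun x => ((H x : ℝ)) ^ (-(1 / 2 : ℝ)), ?_, fun x => Real.rpow_pos_of_pos (NNReal.coe_pos.2 (hHpos x)) _, ?_, ?_, ?_⟩
  · -- (0) continuity
    exact (NNReal.continuous_coe.comp hHcont).rpow_const fun x => Or.inl (NNReal.coe_pos.2 (hHpos x)).ne'
  · -- (2) type `(P_Δ, modDelta)` (adapted from ★ p854922)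
    intro p x hp
    have hΔ : IsUnit (detDelta L e dV hdV dW hdW p) := isUnit_detDelta_of_isSiegelDelta L e dV hdV dW hdW p hp
    have hD := isUnit_det_D L e dV hdV dW hdW hp
    -- `π(p x) = det D_p • π(x)`
    have hπp : π (p * x) = ((hD.unit : (AdeleRing (𝓞 L) L)ˣ) : AdeleRing (𝓞 L) L) • π x := by
      rw [← hπrow (p * x), ← hπrow x]
      funext J
      rw [Pi.smul_apply, smul_eq_mul, IsUnit.unit_spec, Subgroup.coe_mul, Units.val_mul, ← Matrix.mul_assoc,
        frame_mul_coe_of_isSiegelDelta L e dV hdV dW hdW hp, Matrix.mul_assoc,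
        compound_mul_apply_of_card_eq (card_fin_eq n)]
    have hHp : H (p * x) = IdeleClassGroup.ideleNorm L hD.unit * H x := by
      rw [hH]; dsimp only; rw [hπp, vecHeight_smul (hHfin x)]
    have hnorm := ideleNorm_detDelta_mul_ideleNorm_det_D L e dV hdV dW hdW hdV0 hdW0 hp hΔ hD
    have hDinv : IdeleClassGroup.ideleNorm L hD.unit = (IdeleClassGroup.ideleNorm L hΔ.unit)⁻¹ :=
      eq_inv_of_mul_eq_one_right hnorm
    have hmod : modDelta L e dV hdV dW hdW p = Real.sqrt (IdeleClassGroup.ideleNorm L hΔ.unit : ℝ) := by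
      rw [modDelta, dif_pos hΔ, coe_ideleNorm]
    dsimp only
    rw [hHp, hDinv, NNReal.coe_mul, NNReal.coe_inv, hmod, Real.sqrt_eq_rpow,
      Real.mul_rpow (inv_nonneg.2 (NNReal.coe_nonneg _)) (NNReal.coe_nonneg _), Real.inv_rpow (NNReal.coe_nonneg _),
      Real.rpow_neg (NNReal.coe_nonneg _), inv_inv]
  · -- (3) lower bound on compacta (adapted from ★ p854922): `h(π k) ≤ H(k^{(n)}) h(ξ₀)` with `H` bounded on `K`
    intro K hK
    obtain ⟨B, hB⟩ := exists_matHeightBound_compound_le_of_isCompact L (k := n) (hK.image continuous_subtype_val)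
    set B' : ℝ := max ((B : ℝ) * (vecHeight L (principalVec L ξ₀) : ℝ)) 1 with hB'
    have hB'pos : 0 < B' := lt_of_lt_of_le zero_lt_one (le_max_right _ _)
    refine ⟨B' ^ (-(1 / 2 : ℝ)), Real.rpow_pos_of_pos hB'pos _, fun k hk => ?_⟩
    have hle : (H k : ℝ) ≤ B' := by
      rw [hH]; dsimp only
      refine le_trans ?_ (le_max_left _ _)
      have h1 := vecHeight_principalVec_vecMul_compound_le L hξ₀ne (k : GL (Fin (n + n)) (AdeleRing (𝓞 L) L))
      have h2 := (hB _ ⟨k, hk, rfl⟩).1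
      calc (vecHeight L (principalVec L ξ₀ ᵥ* compound n ((k : GL (Fin (n + n)) (AdeleRing (𝓞 L) L)) :
              Matrix (Fin (n + n)) (Fin (n + n)) (AdeleRing (𝓞 L) L))) : ℝ)
          ≤ (matHeightBound L (compound n ((k : GL (Fin (n + n)) (AdeleRing (𝓞 L) L)) :
              Matrix (Fin (n + n)) (Fin (n + n)) (AdeleRing (𝓞 L) L))) : ℝ) * (vecHeight L (principalVec L ξ₀) : ℝ) := by
            exact_mod_cast h1
        _ ≤ (B : ℝ) * (vecHeight L (principalVec L ξ₀) : ℝ) :=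
            mul_le_mul_of_nonneg_right (by exact_mod_cast h2) (NNReal.coe_nonneg _)
    exact Real.rpow_le_rpow_of_nonpos (NNReal.coe_pos.2 (hHpos k)) hle (by norm_num)
  · -- (4) Godement's floor (adapted from ★ p854922): `1 ≤ H((k⁻¹)^{(n)}) h(ξ_γ k^{(n)})`, `ξ_γ` rational non-zero, `H` bounded on `K`
    intro K hK
    obtain ⟨B, hB⟩ := exists_matHeightBound_compound_le_of_isCompact L (k := n) (hK.image continuous_subtype_val)
    set B' : ℝ := max (B : ℝ) 1 with hB'
    have hB'pos : 0 < B' := lt_of_lt_of_le zero_lt_one (le_max_right _ _)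
    refine ⟨B' ^ (1 / 2 : ℝ), fun k hk γ => ?_⟩
    obtain ⟨γ₀, hγ₀⟩ := MonoidHom.mem_range.1 γ.2
    have hγ : (γ : HA L e dV hdV dW hdW) =
        UnitaryGroup.toAdelic (Fp L) L (IsCMField.complexConj L) (n + n) (hermD L e dV hdV dW hdW) γ₀ := hγ₀.symm
    set ξγ : Set.powersetCard (Fin (n + n)) n → L := fun J =>
      compound n (R₀L * ((γ₀ : GL (Fin (n + n)) L) : Matrix (Fin (n + n)) (Fin (n + n)) L)) I₁ J with hξγ
    have hξγne : ξγ ≠ 0 := frame_mul_compound_row_ne_zero L (γ₀ : GL (Fin (n + n)) L) I₁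
    have hπγ : π ((γ : HA L e dV hdV dW hdW) * k) = principalVec L ξγ ᵥ*
        compound n ((k : GL (Fin (n + n)) (AdeleRing (𝓞 L) L)) : Matrix (Fin (n + n)) (Fin (n + n)) (AdeleRing (𝓞 L) L)) := by
      rw [← hπrow, hγ]; exact pluckerVec_ratMul_eq_principalVec_vecMul L e dV hdV dW hdW γ₀ k I₁
    have hfloor := one_le_matHeightBound_compound_inv_mul_vecHeight L hξγne (k : GL (Fin (n + n)) (AdeleRing (𝓞 L) L))
    have h2 := (hB _ ⟨k, hk, rfl⟩).2
    have hge : B'⁻¹ ≤ (H ((γ : HA L e dV hdV dW hdW) * k) : ℝ) := by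
      rw [hH]; dsimp only; rw [hπγ]
      have h3 : (1 : ℝ) ≤ B' * (vecHeight L (principalVec L ξγ ᵥ* compound n ((k : GL (Fin (n + n)) (AdeleRing (𝓞 L) L)) :
          Matrix (Fin (n + n)) (Fin (n + n)) (AdeleRing (𝓞 L) L))) : ℝ) := by
        calc (1 : ℝ) ≤ (matHeightBound L (compound n (((k : GL (Fin (n + n)) (AdeleRing (𝓞 L) L))⁻¹ :
                  GL (Fin (n + n)) (AdeleRing (𝓞 L) L)) : Matrix (Fin (n + n)) (Fin (n + n)) (AdeleRing (𝓞 L) L))) : ℝ) *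
                (vecHeight L (principalVec L ξγ ᵥ* compound n ((k : GL (Fin (n + n)) (AdeleRing (𝓞 L) L)) :
                  Matrix (Fin (n + n)) (Fin (n + n)) (AdeleRing (𝓞 L) L))) : ℝ) := by exact_mod_cast hfloor
          _ ≤ B' * _ := mul_le_mul_of_nonneg_right ((show _ ≤ (B : ℝ) by exact_mod_cast h2).trans (le_max_left _ _))
              (NNReal.coe_nonneg _)
      rw [inv_le_iff_one_le_mul₀ hB'pos, mul_comm]; exact h3
    calc ((H ((γ : HA L e dV hdV dW hdW) * k) : ℝ)) ^ (-(1 / 2 : ℝ))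
        ≤ (B'⁻¹) ^ (-(1 / 2 : ℝ)) := Real.rpow_le_rpow_of_nonpos (inv_pos.2 hB'pos) hge (by norm_num)
      _ = B' ^ (1 / 2 : ℝ) := by rw [Real.inv_rpow hB'pos.le, Real.rpow_neg hB'pos.le, inv_inv]

/-- **PAYMENT OF `sig_K2LiuSiegelDeltaHeightExists`** (socket #15a of unit U3a «SIEGEL EISENSTEIN SERIES» of the K2_Liu road,
`Cruxes/HLiu418/Lines/K2_Liu_CurveThetaSigs_U3a_SiegelEisenstein.lean` ED. 2 :133, TOKEN FOR TOKEN).  **A CONTINUOUS `P_Δ`-HEIGHT EXISTS**: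
for non-degenerate data there is a continuous `Φ : H(𝔸) → ℝ_{>0}` of type `(P_Δ, modDelta)`, `Φ(p x) = |det_Δ p|^{1∕2} · Φ(x)` — the
★ Plücker height of record `h_L(ξ₀ · x^{(n)})^{−1∕2}` (properties (0)(1)(2) of `exists_siegelHeight_continuous`).
[cite: Garrett2018, §3.10] [cite: MoeglinWaldspurger1995, I.2.2, II.1.5] -/
theorem siegelDeltaHeightExists :
    ∀ (L : Type) [Field L] [NumberField L] [IsCMField L] {N M n : ℕ} (e : Fin N × Fin M ≃ Fin n)
      (dV : Fin N → L) (hdV : ∀ i, IsCMField.complexConj L (dV i) = dV i) (_hdV0 : ∀ i, dV i ≠ 0)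
      (dW : Fin M → L) (hdW : ∀ i, IsCMField.complexConj L (dW i) = dW i) (_hdW0 : ∀ i, dW i ≠ 0),
      ∃ Φ : HA L e dV hdV dW hdW → ℝ, Continuous Φ ∧ (∀ x, 0 < Φ x) ∧
        ∀ p x : HA L e dV hdV dW hdW, IsSiegelDelta L e dV hdV dW hdW p →
          Φ (p * x) = modDelta L e dV hdV dW hdW p * Φ x := by
  intro L _ _ _ N M n e dV hdV hdV0 dW hdW hdW0
  obtain ⟨Φ, h0, h1, h2, -, -⟩ := exists_siegelHeight_continuous L e dV hdV dW hdW hdV0 hdW0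
  exact ⟨Φ, h0, h1, h2⟩

end Doubled

end Summit.HodgeConjecture.HodgeConjecture.Cruxes.HLiu418.K2LiuSiegelDeltaHeightExists

end
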